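import Summits.QuantumFields.BalabanUV.Beta.GAN24.WSlotOfShapes
import Summits.QuantumFields.BalabanUV.Beta.GAN24.StencilSlotSThree
import Summits.QuantumFields.BalabanUV.Beta.GAN24.KSlotAssembly

/-!
# `BalabanUV.Beta.GAN24.WSlotThree` — binder row G-an2-4 / (CONV-C), `d = 3`, `Lc ≥ 2`: the wall's UNIFORM SECOND-ORDER binder `hW` for
# an2's family `BalabanStepW2.WbalOf` ⇐ «T2Shape» ∧ (the mixed binder table's shape) ALONE — K-slot and «E3Shape» discharged BY NAME

NOT IN PRINT; OUR PROOF ATTEMPT (G-an2-4 formalisation swarm, idle leaf seat `b2b-balaban-gan24-formalise-leaf-07`, gen 11; module name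
PROVISIONAL — the row owner gan24-p1 / the (P4) author an2 may rename or re-home it).  HONEST FRAMING (cell contract, verbatim): «discharging
`BetaPertH` makes Bałaban's UV stability UNCONDITIONAL — a real constructive-QFT result; it is NOT the continuum limit and NOT the Clay problem.»
HONEST DEPENDENCY (verbatim): «continuum YM on T⁴ ⇐ BetaPertH ∧ nine spine estimates (0/9 proved); BetaPertH ⇐ (D1) ∧ (D4) ∧ CAP+tail;
G-an2-4 gates asym, D1 and NE2/3/4.»  [folklore] composition, every input BY NAME: the K-slot `KSlotAssembly.convCKWall_holds` (road P1,
p204341) supplies `UnitDecayK 3 Lc (sfStep Lc) (smStep 3 Lc) C δ`; «E3Shape» is `StencilSlotSThree.e3Shape_three` (road S3, p208082); both feed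
the generic W-slot plug `WSlotOfShapes.hW_of_shapes`.  No estimate, no cited fact, no `def`, no `Prop` mirror.
NOTHING of the wall is discharged unconditionally: `hW` is concluded FROM the located shape «T2Shape» (the `j`-uniform `LocStencil₂` locality
of the NORMALISED bi-stencil binder tables `unitS₂ (sfStep Lc j) (smStep 3 Lc j) (T₂ j)` — for an2's Stage-B `T2Of`: the recursive value
4-jet `e4OfW` + `wilsonW₂` + the `vh₂S` border; NOT IN PRINT for the typed objects, OPEN, asserted nowhere) and the mixed binder table's own
`LocStencilFM` shape with field–field support (an1's `mixFFAt` is field–field-valued by definition).  The Cauchy half `hWall` is untouched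
(it needs the drift twin «T2Drift», a Lipschitz form of `W2SymOfK` in its kernel and table slots — not in the tree —, `CauchyDecayK` (tree)
and «E3Drift» (tree at `d = 3`)).  NEVER «W-slot closed», NEVER «G-an2-4 closed».  0 wall binders instantiated.  NOT summit progress.

## What is proved (`d = 3`, `Lc ≥ 2`)
* `unitDecayK_three` — the K-slot's decay half in the adopted units, unpacked from `ConvCKWall 3 Lc` (bookkeeping).
* `locStencil_unitS_Spure_three` — the normalised first FIELD table `Spure` of an2's Lagrangian chart is a `LocStencil` family with ONE constant
  and ONE rate along the whole tower, UNCONDITIONALLY (= «E3Shape» + gan24-p1's `j`-free (V-H) piece).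
* **`hW_three_of_T2Shape`** — `«T2Shape» C₂ δ₂ → 0 < δ₂ → LocStencilFM Lc mixFF CM₂ δ₄ → 0 < δ₄ → (mixFF field–field-valued) →
  ∃ Cw δW, 0 < δW ∧ ∀ j, VertexFamily₂ (unitW (sfStep Lc j) (smStep 3 Lc j) (WbalOf 3 Lc cE cVH cΛ T₂ mixFF j)) Lc Cw δW` — the pair
  `(hW₂, hδW)` of `StencilSlotWallThree.d1Drift_JsBalOf_iff_three_of_diffRows` / the binder `hW` of `HessKerConvCKPlug.d1Drift_JsBalOf_iff_of_convCKWall`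
  for `W := WbalOf 3 Lc cE cVH cΛ T₂ mixFF`.
-/

noncomputable section

open Literature.MathematicalPhysics.QuantumFieldTheory
open Literature.MathematicalPhysics.QuantumFieldTheory.Balaban1983to89
open Literature.MathematicalPhysics.QuantumFieldTheory.Balaban1983to89.Beta
open ExpKernelCalculus (MKer VertexFamily₂)
open OneStepResolventKernel (Fib LocStencil)
open BalabanCompositeJets (LocStencil₂)
open SecondOrderResponse (LocStencilFM)
open BalabanStepW2 (Spure WbalOf)
open Summit.QuantumFields.BalabanUV.Beta.HessKerDressedUnits (unitS unitW)
open Summit.QuantumFields.BalabanUV.Beta.SecondOrderUnits (unitS₂)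
open Summit.QuantumFields.BalabanUV.Beta.GAN24.CombesThomas (sfStep smStep UnitDecayK)
open Summit.QuantumFields.BalabanUV.Beta.GAN24.StencilSlotOfE3 (one_le_of_two_le)
open Summit.QuantumFields.BalabanUV.Beta.GAN24.StencilSlotSThree (e3Shape_three)
open Summit.QuantumFields.BalabanUV.Beta.GAN24.KSlotAssembly (convCKWall_holds)
open Summit.QuantumFields.BalabanUV.Beta.GAN24.WSlotOfShapes (locStencil_unitS_Spure hW_of_shapes)

namespace Summit.QuantumFields.BalabanUV.Beta.GAN24.WSlotThree

variable {Lc : ℕ} [NeZero Lc]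

/-- [folklore] The K-slot's DECAY HALF in the adopted units at `d = 3`, `Lc ≥ 2`, unpacked from road P1's `ConvCKWall 3 Lc`
(`KSlotAssembly.convCKWall_holds`): `∃ C δ, 0 < δ ∧ UnitDecayK 3 Lc (sfStep Lc) (smStep 3 Lc) C δ`. -/
theorem unitDecayK_three (hLc : 2 ≤ Lc) : ∃ C δ : ℝ, 0 < δ ∧ UnitDecayK 3 Lc (sfStep Lc) (smStep 3 Lc) C δ := by
  obtain ⟨C, δ, _, _, hδ, -, -, hK, -⟩ := convCKWall_holds (Lc := Lc) hLc
  exact ⟨C, δ, hδ, hK⟩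

/-- **THE NORMALISED FIRST FIELD TABLE `Spure` OF an2's LAGRANGIAN CHART IS A UNIFORM `LocStencil` FAMILY AT `d = 3`, `Lc ≥ 2`**
(unconditional): «E3Shape» (`StencilSlotSThree.e3Shape_three`) into `WSlotOfShapes.locStencil_unitS_Spure`. [folklore] composition. -/
theorem locStencil_unitS_Spure_three (hLc : 2 ≤ Lc) (cE cVH cΛ : ℝ) :
    ∃ Cs δs : ℝ, 0 < δs ∧ ∀ j, LocStencil (unitS (sfStep Lc j) (smStep 3 Lc j) (Spure 3 Lc cE cVH cΛ j)) Cs δs := by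
  obtain ⟨C₃, δ₃, hδ₃, hE3⟩ := e3Shape_three (Lc := Lc) hLc cE cVH cΛ
  exact locStencil_unitS_Spure (one_le_of_two_le hLc) hE3 hδ₃

/-- **THE WALL's UNIFORM W-ROW `hW` AT `d = 3`, `Lc ≥ 2`, FROM «T2Shape» AND THE MIXED-TABLE SHAPE ALONE** [folklore composition]: for
an2's second-order family `W := WbalOf 3 Lc cE cVH cΛ T₂ mixFF` (any colour constants, any bi-stencil binder family `T₂`, any field–field-valued
mixed binder table `mixFF`), the hypotheses «T2Shape» (`hT₂` — located, OPEN, asserted nowhere) and `LocStencilFM Lc mixFF CM₂ δ₄` give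
`∃ Cw δW, 0 < δW ∧ ∀ j, VertexFamily₂ (unitW (sfStep Lc j) (smStep 3 Lc j) (W j)) Lc Cw δW`; the K-slot (`KSlotAssembly.convCKWall_holds`) and
«E3Shape» (`StencilSlotSThree.e3Shape_three`) are TREE THEOREMS and enter BY NAME. -/
theorem hW_three_of_T2Shape (hLc : 2 ≤ Lc) (cE cVH cΛ : ℝ)
    {T₂ : ℕ → Fin (3 + 1) → (Fin (3 + 1) → ℤ) → Fin (3 + 1) → (Fin (3 + 1) → ℤ) → MKer (3 + 1) (Fib 3)} {C₂ δ₂ : ℝ}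
    (hT₂ : ∀ j, LocStencil₂ (unitS₂ (sfStep Lc j) (smStep 3 Lc j) (T₂ j)) C₂ δ₂) (hδ₂ : 0 < δ₂)
    {mixFF : Fin (3 + 1) → (Fin (3 + 1) → ℤ) → Fin (3 + 1) → (Fin (3 + 1) → ℤ) → MKer (3 + 1) (Fib 3)} {CM₂ δ₄ : ℝ}
    (hmix : LocStencilFM Lc mixFF CM₂ δ₄) (hδ₄ : 0 < δ₄)
    (hfm : ∀ κ u ρ w x z (α μ' : Fin (3 + 1)), mixFF κ u ρ w x z (Sum.inl α) (Sum.inr μ') = 0)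
    (hm : ∀ κ u ρ w x z (μ' : Fin (3 + 1)) (b : Fib 3), mixFF κ u ρ w x z (Sum.inr μ') b = 0) :
    ∃ Cw δW : ℝ, 0 < δW ∧
      ∀ j, VertexFamily₂ (unitW (sfStep Lc j) (smStep 3 Lc j) (WbalOf 3 Lc cE cVH cΛ T₂ mixFF j)) Lc Cw δW := by
  obtain ⟨C, δ, _, _, hδ, -, -, hK, -⟩ := convCKWall_holds (Lc := Lc) hLc
  obtain ⟨C₃, δ₃, hδ₃, hE3⟩ := e3Shape_three (Lc := Lc) hLc cE cVH cΛ
  exact hW_of_shapes (one_le_of_two_le hLc) hK hδ hE3 hδ₃ hT₂ hδ₂ hmix hδ₄ hfm hm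

end Summit.QuantumFields.BalabanUV.Beta.GAN24.WSlotThree

end
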